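import Summits.QuantumFields.YangMills.Theorems.BalabanUVNodesN27SpineGivenEndpointR13SepCoPHSpineReadingOfRecordVCutFSC
import Summits.QuantumFields.YangMills.Theorems.BalabanUVNodesN21ShellSplitOfRecord13CoPHTreeGaugeChartGuarded

/-!
# K3⁷ · THE TREE-GAUGE CHART ROAD REACHES THE ITEM: `Theses.BalabanUVNodes.SpineGivenEndpointR13SepCoPH` in v4∕v5's `PinnedAtLive jc sh cr` shape with the N21 face ON THE LIVE
# LINE supplied by junction №5 (file 19) through its guarded form (file 20 `shellWeightBound_guarded₁₃CoPH_of_treeGaugeChartLaws` at `sh := shellSplitOfRecord₁₃At 2 K₀ ρA ρB`) —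
# dag-n27-c's leaf HC4L `spineGivenEndpointR13SepCoPH_of_liveCrOfRecord₁₃VAt_cut_offLiveOneTerm_keyedFacesP_fsc` (p601691 §2) with its `h21` binder DISCHARGED modulo the road's letters

Track A of `YM-PLAN.md` (cell `pub-ymgap`, HUMAN RULING D-0062 ∕ D-0149 width seats), node **N21** → composite N27; WIDTH SEAT `pub-ymgap-dag-n21-w2` (gen 2), file 21 — the twin of my
p609777 (`…N27SpineGivenEndpointR13SepCoPHChartRoadVCut`, fixed-centre chart road) for the TREE-GAUGE chart road, i.e. with LOCATED-1 (p612378) REPAIRED: the window letter is asked of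
the GAUGE-FIXED block fibre density along a block of the prover's choice.  THEOREMS ONLY: 0 `def`, 0 `sorry`; COUNT-NEUTRAL; `--kind proof --supports stmt-QuantumFields-20544 --as helper`;
a route-facing leaf, nothing may import it.  Imports dag-n27-c's HC4L (→ UC4, dag-n19-w3's FSC composer, dag-n20-w1's one-term reading, Theses) and my file 20.  Restates nothing; the
composer is CONSUMED BY NAME (ONE application), nothing of dag-n27-c's retyped.

WHAT IS PROVED ([bookkeeping]; ONE application).  ★★ `spineGivenEndpointR13SepCoPH_of_treeGaugeChartRoad_cut_offLiveOneTerm_fsc`: THE ITEM from HC4L's displayed hypotheses with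
`sh := shellSplitOfRecord₁₃At 2 K₀ ρA ρB` — `hrates`, `hζm` (H-ζ) on the live guard, `h20` (N20's keyed witness), `h19` (N19′'s FSC-keyed core edge on the cores `weight − shell OF
RECORD`), `htarget` (off-live Target row) — EXCEPT `h21`, REPLACED by the tree-gauge chart road's per-tuple data on the live guard: `htg : ∀ F θ hP, (guard ∧ LiveSel) → Admissible →
∀ g₀ os, ∃ DA DB, widths' signs ∧ 0 ≤ D_K ∧ Σ D_K ρ_K < ∞ ∧ the two per-(K, t, a) families of file 19 §3` (`∃ (T, U₀, b)` + per exterior field a chart package for the gauge-fixed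
block fibre law); inside, `E := EOfRecord₁₃ F 2 θ.toStage13Params`, `hsel :=` the guard's live conjunct, (H-U) ∕ `0 ≤ ζ` by the tree's theorems (file 20).

HONEST FRAMING.  NOT a discharge: a term of the item's type under displayed hypotheses (audit `proof.conditional`), every one inhabited for no family today (K0⁷ OPEN); the tree-gauge ∕
block ∕ chart data are located letters (loop-free tree, printed gauge invariances, small-field window of the GAUGE-FIXED fibre density, density presentation, reading identity, cut-chart-law
(M1) — NOT PRINTED, NOT proved); the rates, N20's witness, N19′'s edge, the Target are HYPOTHESES; `jc`, `ρA`, `ρB`, `K₀` free; nothing of Bałaban's asserted or instantiated; NE7c NOT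
proved; N21 ∕ N27 NOT discharged; K3⁷ NOT claimed, skeleton v5 UNTOUCHED; counts UNMOVED (typed 28∕28 · discharged 5∕27); one finite four-torus programme at fixed `ε` — NOT ℝ⁴, NOT
infinite volume, NOT OS, NOT a mass gap, NOT Clay.
-/

set_option autoImplicit false

namespace Summit.QuantumFields.YangMills.Theorems.BalabanUVNodesN27SpineRecord

open scoped BigOperators ENNReal
open MeasureTheory Metric
open Literature.MathematicalPhysics.QuantumFieldTheory.Balaban1983to89
open Literature.MathematicalPhysics.QuantumFieldTheory.Balaban1983to89.T4Continuum
open Literature.MathematicalPhysics.QuantumFieldTheory.Balaban1983to89.Node00 hiding dimSU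
open T4WeightBudget (RelWeightBound)
open T4IndicatorShell (ShellWeightBound)
open T4ShellMeasure (SlotAntiConcentration)
open T4ShellMeasureDet (blockLaw)
open T4ContinuumYM4Torus (ForSmallCouplings)
open T4TreeGaugeFixing (NoClosedLoop fixTo)
open GaugeField (GaugeInvariant)
open Summit.QuantumFields.BalabanUV.T4Continuum.Spine
open NE7 (Target)
open Summit.QuantumFields.YangMills.Theses.BalabanUVNodes (SpineGivenEndpointR13SepCoPH)
open YMDAG.UVSplit hiding SU
open Summit.QuantumFields.YangMills.Theorems.N21ShellSplitOfRecord13CoPH (WidthLetter₁₃CoPH shellSplitOfRecord₁₃At cubeStat cubeDensityOfDatum₉)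
open Summit.QuantumFields.YangMills.Theorems.N21ChartJunctionKeyed (shellWeightBound_guarded₁₃CoPH_of_treeGaugeChartLaws)
open Summit.QuantumFields.BalabanUV.T4Continuum.ShellMeasureExpChartSUN (SUN BlockChartSU expFibreChartSU chartWeightSU)
open Summit.QuantumFields.BalabanUV.T4Continuum.ShellMeasureScalingSUN (windowSU)
open Summit.QuantumFields.BalabanUV.T4Continuum.ShellMeasureExpJacobianSUN (expJacWeightSU)
open Summit.QuantumFields.BalabanUV.T4Continuum.ShellMeasureExpHaarAreaSUN (kappaSU)

variable (K₀ : ℕ) (jc : (F : T4Family) → (θ : Stage13HParams F 2) → θ.Provisos₁₃CoPH F 2 → (ℕ → ℝ) → List (ULoop F) → ℕ → ℕ)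
  (ρA ρB : WidthLetter₁₃CoPH 2)
  (rr : (F : T4Family) → (θ : Stage13HParams F 2) → θ.Provisos₁₃CoPH F 2 → (ℕ → ℝ) → List (ULoop F) → RateCarriers 2)
  (P : ∀ {F : T4Family}, Datum F 2 → RateCarriers 2 → Prop)

/-- ★★ **THE ITEM, WITH THE N21 FACE ON THE LIVE LINE FROM THE TREE-GAUGE CHART ROAD.**  dag-n27-c's HC4L with `sh := shellSplitOfRecord₁₃At 2 K₀ ρA ρB` and `h21 :=
⟨_, shellWeightBound_guarded₁₃CoPH_of_treeGaugeChartLaws K₀ jc ρA ρB (guard ∧ LiveSel) …⟩` — the tree-gauge chart road's `ShellWeightBound` at `crOfRecord₁₃VAt K₀ (jc F θ hP g₀ os) sh`,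
whose carriers ARE HC4L's `(1, classSet₁₃, weightA₁₃, weightB₁₃, sh.1, sh.2)` (n20-d's `rfl` dictionary) and whose weight is the canonical `wshInf`.  Displayed, besides HC4L's
`hrates hζm h20 h19 htarget`: `htg` = per live-guarded admissible tuple, `∃ DA DB`, the widths' signs, `0 ≤ D_K`, `Σ_K D_K ρ_K < ∞` and the two per-(K, t, a) families of file 19 §3
(`∃ (T, U₀, b)` + per exterior field a chart package for the GAUGE-FIXED block fibre law).  NOT a discharge. [bookkeeping] -/
theorem spineGivenEndpointR13SepCoPH_of_treeGaugeChartRoad_cut_offLiveOneTerm_fsc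
    (hrates : ∀ (F : T4Family) (θ : Stage13HParams F 2) (hP : θ.Provisos₁₃CoPH F 2), (θ.ZhUnity F 2 ∧ θ.SlotsNondegenerate₁₃ F 2) → θ.Admissible F 2 →
      B16.EndStatementBPrinted (datumOfRecord₁₃CoPH F 2 θ hP).C → DagBinding.EndpointExistence (datumOfRecord₁₃CoPH F 2 θ hP).C.toB12 →
        ForSmallCouplings (datumOfRecord₁₃CoPH F 2 θ hP) fun g₀ => ∀ os : List (ULoop F), P (datumOfRecord₁₃CoPH F 2 θ hP) (rr F θ hP g₀ os))
    (hζm : ∀ (F : T4Family) (θ : Stage13HParams F 2), θ.Provisos₁₃CoPH F 2 → ((θ.ZhUnity F 2 ∧ θ.SlotsNondegenerate₁₃ F 2) ∧ θ.ppSel = ppSelLiveOfRecord F 2 θ.ν θ.τ9 (EOfRecord₁₃ F 2 θ.toStage13Params) (wOfRecord₉ F 2 θ.toStage9Params)) → θ.Admissible F 2 → ZetaMeasurable F 2 θ.ζ)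
    (h20 : ∀ (F : T4Family) (θ : Stage13HParams F 2) (hP : θ.Provisos₁₃CoPH F 2), ((θ.ZhUnity F 2 ∧ θ.SlotsNondegenerate₁₃ F 2) ∧ θ.ppSel = ppSelLiveOfRecord F 2 θ.ν θ.τ9 (EOfRecord₁₃ F 2 θ.toStage13Params) (wOfRecord₉ F 2 θ.toStage9Params)) → θ.Admissible F 2 → ∀ (g₀ : ℕ → ℝ) (os : List (ULoop F)),
      ∃ W : ℕ → ℝ, RelWeightBound 1 (classSet₁₃ θ K₀ g₀) (weightA₁₃ θ hP K₀ g₀ os) (weightB₁₃ θ hP K₀ g₀ os) (badClass₁₃ θ K₀ g₀ (jc F θ hP g₀ os)) W)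
    (htg : ∀ (F : T4Family) (θ : Stage13HParams F 2) (hP : θ.Provisos₁₃CoPH F 2), ((θ.ZhUnity F 2 ∧ θ.SlotsNondegenerate₁₃ F 2) ∧ θ.ppSel = ppSelLiveOfRecord F 2 θ.ν θ.τ9 (EOfRecord₁₃ F 2 θ.toStage13Params) (wOfRecord₉ F 2 θ.toStage9Params)) → θ.Admissible F 2 →
      ∀ (g₀ : ℕ → ℝ) (os : List (ULoop F)),
      ∃ (DA DB : ℕ → ℝ),
        (∀ K, 0 ≤ ρA F θ hP g₀ os K) ∧ (∀ K, 0 ≤ DA K) ∧ (∀ K, 0 ≤ ρB F θ hP g₀ os K) ∧ (∀ K, 0 ≤ DB K) ∧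
        Summable (fun K => DA K * ρA F θ hP g₀ os K) ∧ Summable (fun K => DB K * ρB F θ hP g₀ os K) ∧
        (∀ (K : ℕ) (t : ℝ), |t| ≤ 1 →
      ∀ (a : ↥(cubeIndices (F.P (K₀ + K)) (cubeSide (F.P (K₀ + K)).L θ.ν.M₂ (RkOfRecord (F.P (K₀ + K)).L θ.ν.r (histA₁₃ θ K₀ g₀ K (K₀ + K))) (K₀ + K)))),
        ∃ (T : Finset (PBond (F.P (K₀ + K)) (K₀ + K))) (U₀ : GaugeField (F.P (K₀ + K)) (K₀ + K) (SU 2)) (b : Finset (PBond (F.P (K₀ + K)) (K₀ + K))),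
          NoClosedLoop T ∧ GaugeInvariant (cubeDensityOfDatum₉ F 2 θ.toStage9Params (datumOfRecord₁₃CoPH F 2 θ hP) g₀ os (runA₁₃ F K₀ g₀ K) (histA₁₃ θ K₀ g₀ K) (K₀ + K) t a) ∧ GaugeInvariant (cubeStat F 2 θ.ν (histA₁₃ θ K₀ g₀ K) (Kc := K₀ + K) (k := K₀ + K) a) ∧
          ∀ x : GaugeField (F.P (K₀ + K)) (K₀ + K) (SU 2),
            ∃ (S : ℝ) (c : GaugeField (F.P (K₀ + K)) (K₀ + K) (SU 2)) (R : (↥b → SU 2) → ℝ≥0∞)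
              (U : BlockChartSU 2 b → ℝ) (A : Set (BlockChartSU 2 b)) (f : BlockChartSU 2 b → ℝ≥0∞) (D : ℝ),
              0 ≤ S ∧ S ≤ Real.pi ∧ Measurable R ∧
              (Measure.pi fun _ : ↥b => (HaarData.haar : Measure (SU 2))).withDensity
                  (fun y => ((cubeDensityOfDatum₉ F 2 θ.toStage9Params (datumOfRecord₁₃CoPH F 2 θ hP) g₀ os (runA₁₃ F K₀ g₀ K) (histA₁₃ θ K₀ g₀ K) (K₀ + K) t a) ∘ fixTo T U₀) (Function.updateFinset x b y))
                = (blockLaw b).withDensity (fun y => windowSU b c S y * R y) ∧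
              MeasurableSet A ∧
              (∀ z ∈ closedBall (0 : BlockChartSU 2 b) S,
                ((cubeStat F 2 θ.ν (histA₁₃ θ K₀ g₀ K) (Kc := K₀ + K) (k := K₀ + K) a) ∘ fixTo T U₀) (Function.updateFinset x b (expFibreChartSU b c z)) = U z) ∧
              ((fun z : BlockChartSU 2 b => chartWeightSU b S (expJacWeightSU (kappaSU 2)) z * R (expFibreChartSU b c z)) =ᵐ[volume] A.indicator f) ∧
              SlotAntiConcentration (((volume : Measure (BlockChartSU 2 b)).withDensity f).restrict A) U (epsOfRecord θ.ν (histA₁₃ θ K₀ g₀ K) (K₀ + K)) (ρA F θ hP g₀ os K) D ∧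
              D ≤ DA K) ∧
        (∀ (K : ℕ) (t : ℝ), |t| ≤ 1 →
      ∀ (a : ↥(cubeIndices (F.P (K₀ + K + 1)) (cubeSide (F.P (K₀ + K + 1)).L θ.ν.M₂ (RkOfRecord (F.P (K₀ + K + 1)).L θ.ν.r (histB₁₃ θ K₀ g₀ K (K₀ + K + 1))) (K₀ + K + 1)))),
        ∃ (T : Finset (PBond (F.P (K₀ + K + 1)) (K₀ + K + 1))) (U₀ : GaugeField (F.P (K₀ + K + 1)) (K₀ + K + 1) (SU 2)) (b : Finset (PBond (F.P (K₀ + K + 1)) (K₀ + K + 1))),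
          NoClosedLoop T ∧ GaugeInvariant (cubeDensityOfDatum₉ F 2 θ.toStage9Params (datumOfRecord₁₃CoPH F 2 θ hP) g₀ os (runB₁₃ F K₀ g₀ K) (histB₁₃ θ K₀ g₀ K) (K₀ + K + 1) t a) ∧ GaugeInvariant (cubeStat F 2 θ.ν (histB₁₃ θ K₀ g₀ K) (Kc := K₀ + K + 1) (k := K₀ + K + 1) a) ∧
          ∀ x : GaugeField (F.P (K₀ + K + 1)) (K₀ + K + 1) (SU 2),
            ∃ (S : ℝ) (c : GaugeField (F.P (K₀ + K + 1)) (K₀ + K + 1) (SU 2)) (R : (↥b → SU 2) → ℝ≥0∞)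
              (U : BlockChartSU 2 b → ℝ) (A : Set (BlockChartSU 2 b)) (f : BlockChartSU 2 b → ℝ≥0∞) (D : ℝ),
              0 ≤ S ∧ S ≤ Real.pi ∧ Measurable R ∧
              (Measure.pi fun _ : ↥b => (HaarData.haar : Measure (SU 2))).withDensity
                  (fun y => ((cubeDensityOfDatum₉ F 2 θ.toStage9Params (datumOfRecord₁₃CoPH F 2 θ hP) g₀ os (runB₁₃ F K₀ g₀ K) (histB₁₃ θ K₀ g₀ K) (K₀ + K + 1) t a) ∘ fixTo T U₀) (Function.updateFinset x b y))
                = (blockLaw b).withDensity (fun y => windowSU b c S y * R y) ∧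
              MeasurableSet A ∧
              (∀ z ∈ closedBall (0 : BlockChartSU 2 b) S,
                ((cubeStat F 2 θ.ν (histB₁₃ θ K₀ g₀ K) (Kc := K₀ + K + 1) (k := K₀ + K + 1) a) ∘ fixTo T U₀) (Function.updateFinset x b (expFibreChartSU b c z)) = U z) ∧
              ((fun z : BlockChartSU 2 b => chartWeightSU b S (expJacWeightSU (kappaSU 2)) z * R (expFibreChartSU b c z)) =ᵐ[volume] A.indicator f) ∧
              SlotAntiConcentration (((volume : Measure (BlockChartSU 2 b)).withDensity f).restrict A) U (epsOfRecord θ.ν (histB₁₃ θ K₀ g₀ K) (K₀ + K + 1)) (ρB F θ hP g₀ os K) D ∧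
              D ≤ DB K))
    (h19 : ∀ (F : T4Family) (θ : Stage13HParams F 2) (hP : θ.Provisos₁₃CoPH F 2), ((θ.ZhUnity F 2 ∧ θ.SlotsNondegenerate₁₃ F 2) ∧ θ.ppSel = ppSelLiveOfRecord F 2 θ.ν θ.τ9 (EOfRecord₁₃ F 2 θ.toStage13Params) (wOfRecord₉ F 2 θ.toStage9Params)) → θ.Admissible F 2 →
      B16.EndStatementBPrinted (datumOfRecord₁₃CoPH F 2 θ hP).C → DagBinding.EndpointExistence (datumOfRecord₁₃CoPH F 2 θ hP).C.toB12 →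
        ForSmallCouplings (datumOfRecord₁₃CoPH F 2 θ hP) fun g₀ => ∀ os : List (ULoop F),
          P (datumOfRecord₁₃CoPH F 2 θ hP) (rr F θ hP g₀ os) → letI : DecidableEq (Σ K, SiteSeqKey F (K₀ + K)) := Classical.decEq _
            ∃ δ : ℕ → ℝ, NE7.Core 1 (F.side ^ 4) (classSet₁₃ θ K₀ g₀) (badClass₁₃ θ K₀ g₀ (jc F θ hP g₀ os))
              (fun K t x => weightA₁₃ θ hP K₀ g₀ os K t x - (shellSplitOfRecord₁₃At 2 K₀ ρA ρB F θ hP g₀ os).1 K t x)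
              (fun K t x => weightB₁₃ θ hP K₀ g₀ os K t x - (shellSplitOfRecord₁₃At 2 K₀ ρA ρB F θ hP g₀ os).2 K t x) δ ∧ Summable δ)
    (htarget : ∀ (F : T4Family) (θ : Stage13HParams F 2) (hP : θ.Provisos₁₃CoPH F 2), ((θ.ZhUnity F 2 ∧ θ.SlotsNondegenerate₁₃ F 2) ∧ ¬ θ.ppSel = ppSelLiveOfRecord F 2 θ.ν θ.τ9 (EOfRecord₁₃ F 2 θ.toStage13Params) (wOfRecord₉ F 2 θ.toStage9Params)) → θ.Admissible F 2 →
      B16.EndStatementBPrinted (datumOfRecord₁₃CoPH F 2 θ hP).C → DagBinding.EndpointExistence (datumOfRecord₁₃CoPH F 2 θ hP).C.toB12 →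
        ForSmallCouplings (datumOfRecord₁₃CoPH F 2 θ hP) fun g₀ => ∀ os : List (ULoop F), P (datumOfRecord₁₃CoPH F 2 θ hP) (rr F θ hP g₀ os) →
          ∃ δ : ℕ → ℝ, Target ((F.side : ℝ) ^ 4) 1 δ (fun K => T4GenFunBounds.schemeZ ((datumOfRecord₁₃CoPH F 2 θ hP).scheme g₀) os (K₀ + K))) :
    SpineGivenEndpointR13SepCoPH :=
  spineGivenEndpointR13SepCoPH_of_liveCrOfRecord₁₃VAt_cut_offLiveOneTerm_keyedFacesP_fsc K₀ jc (shellSplitOfRecord₁₃At 2 K₀ ρA ρB) rr P hrates hζm h20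
    (fun F θ hP hRg hθ g₀ os =>
      ⟨_, shellWeightBound_guarded₁₃CoPH_of_treeGaugeChartLaws K₀ jc ρA ρB
        (fun F (θ : Stage13HParams F 2) => ((θ.ZhUnity F 2 ∧ θ.SlotsNondegenerate₁₃ F 2) ∧ θ.ppSel = ppSelLiveOfRecord F 2 θ.ν θ.τ9 (EOfRecord₁₃ F 2 θ.toStage13Params) (wOfRecord₉ F 2 θ.toStage9Params)))
        (fun F θ hP hRg hθ g₀ os => by
          obtain ⟨DA, DB, hρA, hDA, hρB, hDB, hsA, hsB, hA, hB⟩ := htg F θ hP hRg hθ g₀ os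
          exact ⟨EOfRecord₁₃ F 2 θ.toStage13Params, DA, DB, hRg.2, hζm F θ hP hRg hθ, hρA, hDA, hρB, hDB, hsA, hsB, hA, hB⟩)
        F θ hP hRg hθ g₀ os⟩)
    h19 htarget

end Summit.QuantumFields.YangMills.Theorems.BalabanUVNodesN27SpineRecord
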